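import Mathlib.Analysis.FunctionalSpaces.SobolevInequality
import Mathlib.Analysis.Calculus.BumpFunction.Basic
import Mathlib.Analysis.Calculus.BumpFunction.InnerProduct
import Mathlib.Analysis.InnerProductSpace.Calculus
import Literature.Analysis.FunctionSpaces.TorusPeriodization
import Literature.Analysis.FunctionSpaces.TorusFourierModes
import HarnessLib

/-!
# Ladyzhenskaya's inequality `‖φ‖_{L⁴}⁴ ≤ C ‖φ‖_{L²}² ‖φ‖_{H¹}²` on the flat two-torus

Analysis/FunctionSpaces file (serves the two-dimensional uniqueness theorem of Leray–Hopf weak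
solutions on `UnitAddTorus (Fin 2)`, `Literature.Analysis.FluidPDE.lions_prodi_uniqueness_torus2`, whose printed
proof — Foias–Manley–Rosa–Temam 2001, Ch. II Thm. 7.3 with App. II.A (A.47) — bounds the
trilinear term by "the Ladyzhenskaya inequality `‖u‖_{L⁴}² ≤ c |u| ‖u‖`" (op. cit. (A.47);
Ladyzhenskaya 1959; Temam 1984, Ch. III, Lemma 3.3)).

* `lintegral_enorm_pow_four_le` — **Ladyzhenskaya's inequality on a two-dimensional space**:
  for a `C¹` compactly supported `g : E → F` (`dim E = 2`, `F` a real inner product space,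
  `μ` a Haar measure), `∫ ‖g‖⁴ ≤ 4 C² (∫ ‖g‖²)(∫ ‖Dg‖²)` with `C` Mathlib's Gagliardo–Nirenberg–
  Sobolev constant: Mathlib's `lintegral_pow_le_pow_lintegral_fderiv` (`p = 1`, `p* = 2` in
  dimension two) applied to `‖g‖²`, whose derivative is bounded by `2‖g‖‖Dg‖`, and
  Cauchy–Schwarz (Ladyzhenskaya's original argument replaced the Sobolev inequality by a
  product of one-dimensional estimates; the constants are immaterial here).
* `Torus.exists_ladyzhenskaya_const` — **the inequality on `UnitAddTorus (Fin 2)`**: there is a finite constant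
  `C` with `∫ ‖φ‖⁴ ≤ C (∫ ‖φ‖²)(∫ ‖φ‖² + ∑ᵢ ∫ ‖∂ᵢφ‖²)` for every `C¹` field `φ` on the flat
  two-torus (lower Lebesgue integrals): cut the lift `φ ∘ proj` off with a fixed bump equal to
  `1` on the unit cube, apply the planar inequality, and compare planar integrals of lifts
  over balls with integrals over the torus (`Torus.setLIntegral_lift_le`,
  `Torus.setLIntegral_unitCube_lift` of `TorusPeriodization`).

## Mathlib / tree search

Mathlib has the Gagliardo–Nirenberg–Sobolev inequality for compactly supported `C¹` functions
(`MeasureTheory.lintegral_pow_le_pow_lintegral_fderiv`, `eLpNorm_le_eLpNorm_fderiv_*`) but no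
Ladyzhenskaya / multiplicative interpolation inequality and nothing on the torus (searched
`Ladyzhenskaya`, `interpolation` + `eLpNorm`, `GagliardoNirenberg`); the tree has the
three-dimensional whole-space analogue `L² ∩ Ḣ¹ ⊂ L^{10/3}` (`FluidPDE/MultiplicativeInequality`)
and the cube/lift dictionary of `TorusPeriodization`.

## References

* O. A. Ladyzhenskaya, *Solution "in the large" of the nonstationary boundary value problem for
  the Navier–Stokes system with two space variables*, Comm. Pure Appl. Math. 12 (1959), 427–433,
  Lemma 1.
* C. Foias, O. Manley, R. Rosa, R. Temam, *Navier–Stokes Equations and Turbulence*, CUP 2001,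
  App. II.A (A.47), PDF p. 116.
* R. Temam, *Navier–Stokes Equations*, 3rd ed., North-Holland 1984, Ch. III §3, Lemma 3.3.
-/

open MeasureTheory Set Filter Topology Metric
open scoped ENNReal NNReal InnerProductSpace

noncomputable section

namespace Literature.Analysis.FunctionSpaces

/-! ### The planar inequality -/

section Planar

variable {E : Type*} [NormedAddCommGroup E] [NormedSpace ℝ E] [MeasurableSpace E] [BorelSpace E]
  [FiniteDimensional ℝ E] (μ : Measure E) [μ.IsAddHaarMeasure]
variable {F : Type*} [NormedAddCommGroup F] [InnerProductSpace ℝ F]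

omit [MeasurableSpace E] [BorelSpace E] [FiniteDimensional ℝ E] in
/-- The derivative of `‖g‖²` is bounded by `2‖g‖‖Dg‖`. [folklore] -/
theorem norm_fderiv_norm_sq_le {g : E → F} (hg : Differentiable ℝ g) (x : E) :
    ‖fderiv ℝ (fun y => ‖g y‖ ^ 2) x‖ ≤ 2 * ‖g x‖ * ‖fderiv ℝ g x‖ := by
  rw [(hg x).hasFDerivAt.norm_sq.fderiv, two_nsmul]
  refine (norm_add_le _ _).trans ?_
  have h1 : ‖(innerSL ℝ (g x)).comp (fderiv ℝ g x)‖ ≤ ‖g x‖ * ‖fderiv ℝ g x‖ := by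
    refine (ContinuousLinearMap.opNorm_comp_le _ _).trans ?_
    rw [innerSL_apply_norm]
  linarith

/-- **Ladyzhenskaya's inequality in two dimensions.** On a two-dimensional real normed space
with a Haar measure `μ`, for every compactly supported `C¹` map `g` into a real inner product
space, `∫ ‖g‖⁴ ≤ 4 C² (∫ ‖g‖²) (∫ ‖Dg‖²)`, `C = lintegralPowLePowLIntegralFDerivConst μ 2`
Mathlib's Gagliardo–Nirenberg–Sobolev constant: the Sobolev inequality `‖w‖_{L²} ≤ C ‖Dw‖_{L¹}`
for `w = ‖g‖²`, `|Dw| ≤ 2‖g‖‖Dg‖`, and Cauchy–Schwarz (Ladyzhenskaya 1959, Lemma 1; FMRT 2001,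
App. II.A (A.47)). [cite: FoiasManleyRosaTemam2001, App. II.A (A.47)] -/
theorem lintegral_enorm_pow_four_le (hE : Module.finrank ℝ E = 2) {g : E → F} (hg : ContDiff ℝ 1 g)
    (hgc : HasCompactSupport g) :
    ∫⁻ x, ‖g x‖ₑ ^ 4 ∂μ ≤ 4 * (lintegralPowLePowLIntegralFDerivConst μ 2 : ℝ≥0∞) *
      ((∫⁻ x, ‖g x‖ₑ ^ 2 ∂μ) * ∫⁻ x, ‖fderiv ℝ g x‖ₑ ^ 2 ∂μ) := by
  set w : E → ℝ := fun y => ‖g y‖ ^ 2 with hw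
  have hwd : ContDiff ℝ 1 w := hg.norm_sq ℝ
  have hwc : HasCompactSupport w := hgc.comp_left (g := fun v : F => ‖v‖ ^ 2) (by simp)
  have hp : (Module.finrank ℝ E : ℝ).HolderConjugate 2 := by
    rw [hE, Nat.cast_ofNat]
    exact Real.HolderConjugate.two_two
  have hGNS := lintegral_pow_le_pow_lintegral_fderiv μ hwd hwc hp
  -- `‖w‖ₑ ^ 2 = ‖g‖ₑ ^ 4`
  have hw4 : ∀ x, ‖w x‖ₑ ^ (2 : ℝ) = ‖g x‖ₑ ^ 4 := fun x => by
    rw [hw, ENNReal.rpow_two]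
    dsimp only
    rw [Real.enorm_eq_ofReal (sq_nonneg _), ← ofReal_norm, ← ENNReal.ofReal_pow (norm_nonneg _),
      ← ENNReal.ofReal_pow (sq_nonneg _), ← pow_mul]
  simp_rw [hw4] at hGNS
  refine hGNS.trans ?_
  -- `∫ ‖Dw‖ ≤ 2 (∫‖g‖²)^{1/2} (∫‖Dg‖²)^{1/2}`
  have hgd : Differentiable ℝ g := hg.differentiable one_ne_zero
  have hmeas_g : AEMeasurable (fun x => ‖g x‖ₑ) μ := hg.continuous.norm.aemeasurable.enorm.congr
    (ae_of_all _ fun x => by simp)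
  have hmeas_Dg : AEMeasurable (fun x => ‖fderiv ℝ g x‖ₑ) μ :=
    (hg.continuous_fderiv one_ne_zero).norm.aemeasurable.enorm.congr (ae_of_all _ fun x => by simp)
  have hDw : ∫⁻ x, ‖fderiv ℝ w x‖ₑ ∂μ ≤
      2 * ((∫⁻ x, ‖g x‖ₑ ^ 2 ∂μ) ^ (1 / 2 : ℝ) * (∫⁻ x, ‖fderiv ℝ g x‖ₑ ^ 2 ∂μ) ^ (1 / 2 : ℝ)) := by
    have hpt : ∀ x, ‖fderiv ℝ w x‖ₑ ≤ 2 * (‖g x‖ₑ * ‖fderiv ℝ g x‖ₑ) := fun x => by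
      have h := norm_fderiv_norm_sq_le hgd x
      rw [← ofReal_norm, ← ofReal_norm, ← ofReal_norm, ← ENNReal.ofReal_mul (norm_nonneg _),
        ← ENNReal.ofReal_ofNat, ← ENNReal.ofReal_mul (by norm_num)]
      exact ENNReal.ofReal_le_ofReal (by linarith)
    calc ∫⁻ x, ‖fderiv ℝ w x‖ₑ ∂μ ≤ ∫⁻ x, 2 * (‖g x‖ₑ * ‖fderiv ℝ g x‖ₑ) ∂μ := lintegral_mono hpt
      _ = 2 * ∫⁻ x, ‖g x‖ₑ * ‖fderiv ℝ g x‖ₑ ∂μ := lintegral_const_mul' _ _ (by norm_num)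
      _ ≤ 2 * ((∫⁻ x, ‖g x‖ₑ ^ (2 : ℝ) ∂μ) ^ (1 / 2 : ℝ) *
            (∫⁻ x, ‖fderiv ℝ g x‖ₑ ^ (2 : ℝ) ∂μ) ^ (1 / 2 : ℝ)) := by
          gcongr
          exact ENNReal.lintegral_mul_le_Lp_mul_Lq μ Real.HolderConjugate.two_two hmeas_g hmeas_Dg
      _ = _ := by simp_rw [ENNReal.rpow_two]
  -- square it
  have hsq : (∫⁻ x, ‖fderiv ℝ w x‖ₑ ∂μ) ^ (2 : ℝ) ≤
      4 * ((∫⁻ x, ‖g x‖ₑ ^ 2 ∂μ) * ∫⁻ x, ‖fderiv ℝ g x‖ₑ ^ 2 ∂μ) := by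
    calc (∫⁻ x, ‖fderiv ℝ w x‖ₑ ∂μ) ^ (2 : ℝ)
        ≤ (2 * ((∫⁻ x, ‖g x‖ₑ ^ 2 ∂μ) ^ (1 / 2 : ℝ) *
            (∫⁻ x, ‖fderiv ℝ g x‖ₑ ^ 2 ∂μ) ^ (1 / 2 : ℝ))) ^ (2 : ℝ) := by gcongr
      _ = 4 * ((∫⁻ x, ‖g x‖ₑ ^ 2 ∂μ) * ∫⁻ x, ‖fderiv ℝ g x‖ₑ ^ 2 ∂μ) := by
          rw [ENNReal.mul_rpow_of_nonneg _ _ (by norm_num), ENNReal.mul_rpow_of_nonneg _ _ (by norm_num),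
            ← ENNReal.rpow_mul, ← ENNReal.rpow_mul]
          norm_num
  calc (lintegralPowLePowLIntegralFDerivConst μ 2 : ℝ≥0∞) * (∫⁻ x, ‖fderiv ℝ w x‖ₑ ∂μ) ^ (2 : ℝ)
      ≤ (lintegralPowLePowLIntegralFDerivConst μ 2 : ℝ≥0∞) *
          (4 * ((∫⁻ x, ‖g x‖ₑ ^ 2 ∂μ) * ∫⁻ x, ‖fderiv ℝ g x‖ₑ ^ 2 ∂μ)) := by gcongr
    _ = _ := by ring

end Planar

/-! ### The inequality on the flat two-torus -/

namespace Torus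

variable {F : Type*} [NormedAddCommGroup F] [InnerProductSpace ℝ F]

/-- The operator norm of the torus derivative of a `C¹` map is at most the sum of the norms of
its partial derivatives, hence `‖Dφ(x)‖² ≤ 2 ∑ᵢ ‖∂ᵢφ(x)‖²` on `UnitAddTorus (Fin 2)`. [folklore] -/
theorem norm_fderiv_sq_le_two_mul_sum {φ : UnitAddTorus (Fin 2) → F} (hφ : IsContDiff 1 φ) (x : UnitAddTorus (Fin 2)) :
    ‖Torus.fderiv φ x‖ ^ 2 ≤ 2 * ∑ i, ‖partialDeriv i φ x‖ ^ 2 := by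
  have h1 : ‖Torus.fderiv φ x‖ ≤ ∑ i, ‖partialDeriv i φ x‖ :=
    ContinuousLinearMap.opNorm_le_bound _ (Finset.sum_nonneg fun i _ => norm_nonneg _) fun h => by
      rw [mul_comm]; exact norm_fderiv_apply_le hφ x h
  have h2 : (∑ i, ‖partialDeriv i φ x‖) ^ 2 ≤ 2 * ∑ i, ‖partialDeriv i φ x‖ ^ 2 := by
    have h := Finset.sum_mul_sq_le_sq_mul_sq Finset.univ (fun i : Fin 2 => (1 : ℝ))
      (fun i => ‖partialDeriv i φ x‖)
    simp only [one_mul, one_pow, Finset.sum_const, Finset.card_univ, Fintype.card_fin, nsmul_eq_mul,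
      Nat.cast_ofNat] at h
    linarith
  calc ‖Torus.fderiv φ x‖ ^ 2 ≤ (∑ i, ‖partialDeriv i φ x‖) ^ 2 := by
        gcongr
    _ ≤ _ := h2

omit [InnerProductSpace ℝ F] in
/-- Pushing `ENNReal.ofReal` through the bound `(4 + 2B²)(‖v‖² + ∑ ‖wᵢ‖²)`. [folklore] -/
theorem ofReal_bound_eq (B : ℝ) (v : F) (w : Fin 2 → F) :
    ENNReal.ofReal ((4 + 2 * B ^ 2) * (‖v‖ ^ 2 + ∑ i, ‖w i‖ ^ 2)) =
      (4 + 2 * ENNReal.ofReal (B ^ 2)) * (‖v‖ₑ ^ 2 + ∑ i, ‖w i‖ₑ ^ 2) := by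
  rw [ENNReal.ofReal_mul (by positivity), ENNReal.ofReal_add (by positivity) (by positivity),
    ENNReal.ofReal_mul (by norm_num), ENNReal.ofReal_ofNat, ENNReal.ofReal_ofNat,
    ENNReal.ofReal_add (sq_nonneg _) (Finset.sum_nonneg fun i _ => sq_nonneg _),
    ENNReal.ofReal_pow (norm_nonneg _), ofReal_norm,
    ENNReal.ofReal_sum_of_nonneg fun i _ => sq_nonneg _]
  congr 2
  exact Finset.sum_congr rfl fun i _ => by rw [ENNReal.ofReal_pow (norm_nonneg _), ofReal_norm]

/-- **Ladyzhenskaya's inequality on the flat two-torus** (Ladyzhenskaya 1959, Lemma 1; FMRT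
2001, App. II.A (A.47): `‖u‖_{L⁴(Ω)} ≤ c|u|^{1/2}‖u‖^{1/2}` in the two-dimensional periodic
case; Temam 1984, Ch. III Lemma 3.3). There is a finite constant `C` such that for every smooth
map `φ : UnitAddTorus (Fin 2) → F` into a real inner product space
`∫ ‖φ‖⁴ ≤ C (∫ ‖φ‖²) (∫ ‖φ‖² + ∑ᵢ ∫ ‖∂ᵢφ‖²)` (lower Lebesgue integrals, inhomogeneous `H¹`
norm since no mean-zero condition is imposed). Proof: cut the lift `φ ∘ proj` off by a fixed
smooth bump equal to `1` on the unit cube and supported in the ball of radius `3`, apply the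
planar inequality `lintegral_enorm_pow_four_le`, and compare planar integrals of lifts over the
ball with integrals over the torus (at most `#window` fundamental domains). [cite: FoiasManleyRosaTemam2001, App. II.A (A.47)] -/
theorem exists_ladyzhenskaya_const (F : Type*) [NormedAddCommGroup F] [InnerProductSpace ℝ F] :
    ∃ C : ℝ≥0∞, C ≠ ⊤ ∧ ∀ (φ : UnitAddTorus (Fin 2) → F), IsSmooth φ →
      ∫⁻ x, ‖φ x‖ₑ ^ 4 ≤ C * ((∫⁻ x, ‖φ x‖ₑ ^ 2) *
        ((∫⁻ x, ‖φ x‖ₑ ^ 2) + ∑ i, ∫⁻ x, ‖partialDeriv i φ x‖ₑ ^ 2)) := by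
  classical
  -- the cut-off: a bump equal to `1` on `closedBall 0 2 ⊇ [0,1)²`, supported in `ball 0 3`
  let χ : ContDiffBump (0 : EuclideanSpace ℝ (Fin 2)) := ⟨2, 3, two_pos, by norm_num⟩
  have hχ1 : ∀ y ∈ unitCube (Fin 2), χ y = 1 := fun y hy =>
    χ.one_of_mem_closedBall (by
      rw [mem_closedBall, dist_zero_right]
      have := norm_le_card_of_mem_unitCube hy
      simpa using this)
  have hχsupp : Function.support (χ : EuclideanSpace ℝ (Fin 2) → ℝ) ⊆ closedBall (0 : EuclideanSpace ℝ (Fin 2)) 3 := by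
    rw [χ.support_eq]; exact ball_subset_closedBall
  have hχd : ContDiff ℝ 1 (χ : EuclideanSpace ℝ (Fin 2) → ℝ) := χ.contDiff
  have hχc : HasCompactSupport (χ : EuclideanSpace ℝ (Fin 2) → ℝ) := χ.hasCompactSupport
  obtain ⟨B, hB⟩ : ∃ B : ℝ, ∀ y, ‖_root_.fderiv ℝ (χ : EuclideanSpace ℝ (Fin 2) → ℝ) y‖ ≤ B :=
    (hχd.continuous_fderiv one_ne_zero).bounded_above_of_compact_support (hχc.fderiv ℝ)
  have hB0 : 0 ≤ B := (norm_nonneg _).trans (hB 0)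
  -- the constants
  set W : ℝ≥0∞ := ((latticeWindow (Fin 2) 4).card : ℝ≥0∞) with hW
  set CG : ℝ≥0∞ := (lintegralPowLePowLIntegralFDerivConst (volume : Measure (EuclideanSpace ℝ (Fin 2))) 2 : ℝ≥0∞) with hCG
  refine ⟨4 * CG * (W * (W * (4 + 2 * ENNReal.ofReal (B ^ 2)))), ?_, fun φ hφ => ?_⟩
  · have hW' : W ≠ ⊤ := ENNReal.natCast_ne_top _
    have hB' : ENNReal.ofReal (B ^ 2) ≠ ⊤ := ENNReal.ofReal_ne_top
    have h4 : (4 : ℝ≥0∞) + 2 * ENNReal.ofReal (B ^ 2) ≠ ⊤ :=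
      ENNReal.add_ne_top.2 ⟨ENNReal.ofNat_ne_top, ENNReal.mul_ne_top ENNReal.ofNat_ne_top hB'⟩
    exact ENNReal.mul_ne_top (ENNReal.mul_ne_top ENNReal.ofNat_ne_top ENNReal.coe_ne_top)
      (ENNReal.mul_ne_top hW' (ENNReal.mul_ne_top hW' h4))
  -- the cut-off lift
  set g : EuclideanSpace ℝ (Fin 2) → F := fun y => χ y • lift φ y with hg
  have hφ1 : IsContDiff 1 φ := hφ.isContDiff (by simp)
  have hφd : ContDiff ℝ 1 (lift φ) := hφ1
  have hgd : ContDiff ℝ 1 g := hχd.smul hφd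
  have hgc : HasCompactSupport g := hχc.smul_right
  have hE : Module.finrank ℝ (EuclideanSpace ℝ (Fin 2)) = 2 := by simp
  have hplanar := lintegral_enorm_pow_four_le (volume : Measure (EuclideanSpace ℝ (Fin 2))) hE hgd hgc
  -- measurability on the torus
  have hφc : Continuous φ := hφ.continuous
  have hmeas4 : AEMeasurable (fun x => ‖φ x‖ₑ ^ 4) volume := (hφc.enorm.measurable.pow_const 4).aemeasurable
  have hmeas2 : AEMeasurable (fun x => ‖φ x‖ₑ ^ 2) volume := (hφc.enorm.measurable.pow_const 2).aemeasurable
  have hmeasD : ∀ i, AEMeasurable (fun x => ‖partialDeriv i φ x‖ₑ ^ 2) volume := fun i =>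
    ((hφ.partialDeriv i).continuous.enorm.measurable.pow_const 2).aemeasurable
  -- (1) the left-hand side: `∫_{UnitAddTorus (Fin 2)} ‖φ‖⁴ = ∫_{cube} ‖g‖⁴ ≤ ∫ ‖g‖⁴`
  have hlhs : ∫⁻ x, ‖φ x‖ₑ ^ 4 ≤ ∫⁻ y, ‖g y‖ₑ ^ 4 := by
    rw [← setLIntegral_unitCube_lift hmeas4]
    calc ∫⁻ y in unitCube (Fin 2), lift (fun x => ‖φ x‖ₑ ^ 4) y
        = ∫⁻ y in unitCube (Fin 2), ‖g y‖ₑ ^ 4 := by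
          refine setLIntegral_congr_fun measurableSet_unitCube fun y hy => ?_
          rw [hg]; dsimp only
          rw [hχ1 y hy, one_smul, lift_apply, lift_apply]
      _ ≤ ∫⁻ y, ‖g y‖ₑ ^ 4 := setLIntegral_le_lintegral _ _
  -- (2) `∫ ‖g‖² ≤ W ∫_{UnitAddTorus (Fin 2)} ‖φ‖²`
  have hg2 : ∫⁻ y, ‖g y‖ₑ ^ 2 ≤ W * ∫⁻ x, ‖φ x‖ₑ ^ 2 := by
    have hpt : ∀ y, ‖g y‖ₑ ^ 2 ≤ (closedBall (0 : EuclideanSpace ℝ (Fin 2)) 3).indicator (lift fun x => ‖φ x‖ₑ ^ 2) y := by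
      intro y
      by_cases hy : y ∈ closedBall (0 : EuclideanSpace ℝ (Fin 2)) 3
      · rw [indicator_of_mem hy, lift_apply, hg]
        dsimp only
        rw [enorm_smul, mul_pow, lift_apply]
        refine mul_le_of_le_one_left bot_le ?_
        have : ‖χ y‖ₑ ≤ 1 := by
          rw [Real.enorm_eq_ofReal χ.nonneg]; exact ENNReal.ofReal_le_one.2 χ.le_one
        calc ‖χ y‖ₑ ^ 2 ≤ 1 ^ 2 := by gcongr
          _ = 1 := one_pow 2
      · have h0 : χ y = 0 := by
          by_contra h
          exact hy (hχsupp (Function.mem_support.2 h))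
        rw [indicator_of_notMem hy, hg]
        dsimp only
        rw [h0, zero_smul, enorm_zero, zero_pow two_ne_zero]
    calc ∫⁻ y, ‖g y‖ₑ ^ 2 ≤ ∫⁻ y, (closedBall (0 : EuclideanSpace ℝ (Fin 2)) 3).indicator (lift fun x => ‖φ x‖ₑ ^ 2) y :=
          lintegral_mono hpt
      _ = ∫⁻ y in closedBall (0 : EuclideanSpace ℝ (Fin 2)) 3, lift (fun x => ‖φ x‖ₑ ^ 2) y :=
          lintegral_indicator measurableSet_closedBall _
      _ ≤ W * ∫⁻ x, ‖φ x‖ₑ ^ 2 := setLIntegral_lift_le hmeas2 subset_rfl (by norm_num)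
  -- (3) `∫ ‖Dg‖² ≤ W (4 ∑ ∫ ‖∂ᵢφ‖² + 2B² ∫ ‖φ‖²)`
  have hDg : ∫⁻ y, ‖_root_.fderiv ℝ g y‖ₑ ^ 2 ≤
      W * ((4 + 2 * ENNReal.ofReal (B ^ 2)) * ((∫⁻ x, ‖φ x‖ₑ ^ 2) + ∑ i, ∫⁻ x, ‖partialDeriv i φ x‖ₑ ^ 2)) := by
    -- pointwise bound by a lift supported in the ball
    obtain ⟨H, hH⟩ : ∃ H : UnitAddTorus (Fin 2) → ℝ≥0∞, H = fun x => (4 + 2 * ENNReal.ofReal (B ^ 2)) *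
      (‖φ x‖ₑ ^ 2 + ∑ i, ‖partialDeriv i φ x‖ₑ ^ 2) := ⟨_, rfl⟩
    have hsumm : AEMeasurable (fun x => ∑ i, ‖partialDeriv i φ x‖ₑ ^ 2) volume :=
      Finset.aemeasurable_fun_sum _ fun i _ => hmeasD i
    have hfg : AEMeasurable (fun x => ‖φ x‖ₑ ^ 2 + ∑ i, ‖partialDeriv i φ x‖ₑ ^ 2) volume :=
      hmeas2.add hsumm
    have hHm : AEMeasurable H volume := by
      rw [hH]
      exact hfg.const_mul _
    have hpt : ∀ y, ‖_root_.fderiv ℝ g y‖ₑ ^ 2 ≤ (closedBall (0 : EuclideanSpace ℝ (Fin 2)) 3).indicator (lift H) y := by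
      intro y
      by_cases hy : y ∈ closedBall (0 : EuclideanSpace ℝ (Fin 2)) 3
      · rw [indicator_of_mem hy, lift_apply, hH]
        dsimp only
        -- real bound: `‖Dg y‖ ≤ ‖D(lift φ) y‖ + B ‖lift φ y‖`
        have hdχ : DifferentiableAt ℝ (χ : EuclideanSpace ℝ (Fin 2) → ℝ) y := (hχd.differentiable one_ne_zero) y
        have hdφ : DifferentiableAt ℝ (lift φ) y := (hφd.differentiable one_ne_zero) y
        have hD : _root_.fderiv ℝ g y =
            χ y • _root_.fderiv ℝ (lift φ) y + (_root_.fderiv ℝ (χ : EuclideanSpace ℝ (Fin 2) → ℝ) y).smulRight (lift φ y) := by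
          rw [hg]; exact fderiv_smul hdχ hdφ
        have hnorm : ‖_root_.fderiv ℝ g y‖ ≤ ‖Torus.fderiv φ (proj y)‖ + B * ‖φ (proj y)‖ := by
          rw [hD]
          refine (norm_add_le _ _).trans (add_le_add ?_ ?_)
          · rw [norm_smul, fderiv_lift]
            refine mul_le_of_le_one_left (norm_nonneg _) ?_
            rw [Real.norm_eq_abs, abs_of_nonneg χ.nonneg]; exact χ.le_one
          · refine (ContinuousLinearMap.norm_smulRight_apply _ _).le.trans ?_
            rw [lift_apply]
            exact mul_le_mul_of_nonneg_right (hB y) (norm_nonneg _)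
        have hsq : ‖_root_.fderiv ℝ g y‖ ^ 2 ≤
            (4 + 2 * B ^ 2) * (‖φ (proj y)‖ ^ 2 + ∑ i, ‖partialDeriv i φ (proj y)‖ ^ 2) := by
          have h1 := norm_fderiv_sq_le_two_mul_sum hφ1 (proj y)
          have h2 : (‖Torus.fderiv φ (proj y)‖ + B * ‖φ (proj y)‖) ^ 2 ≤
              2 * ‖Torus.fderiv φ (proj y)‖ ^ 2 + 2 * (B * ‖φ (proj y)‖) ^ 2 := by
            nlinarith [sq_nonneg (‖Torus.fderiv φ (proj y)‖ - B * ‖φ (proj y)‖)]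
          have h3 : ‖_root_.fderiv ℝ g y‖ ^ 2 ≤ (‖Torus.fderiv φ (proj y)‖ + B * ‖φ (proj y)‖) ^ 2 := by
            gcongr
          have hS0 : 0 ≤ ∑ i, ‖partialDeriv i φ (proj y)‖ ^ 2 := Finset.sum_nonneg fun i _ => sq_nonneg _
          nlinarith [sq_nonneg ‖φ (proj y)‖, sq_nonneg B]
        -- to `ℝ≥0∞`
        have hofReal : ENNReal.ofReal (‖_root_.fderiv ℝ g y‖ ^ 2) ≤ ENNReal.ofReal
            ((4 + 2 * B ^ 2) * (‖φ (proj y)‖ ^ 2 + ∑ i, ‖partialDeriv i φ (proj y)‖ ^ 2)) :=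
          ENNReal.ofReal_le_ofReal hsq
        rw [ENNReal.ofReal_pow (norm_nonneg _), ofReal_norm] at hofReal
        exact hofReal.trans (le_of_eq (ofReal_bound_eq B _ _))
      · have h0 : _root_.fderiv ℝ g y = 0 := by
          refine fderiv_of_notMem_tsupport ℝ fun h => hy ?_
          have hts : tsupport g ⊆ closedBall (0 : EuclideanSpace ℝ (Fin 2)) 3 :=
            closure_minimal ((Function.support_smul_subset_left _ _).trans hχsupp) isClosed_closedBall
          exact hts h
        rw [indicator_of_notMem hy, h0, ← ofReal_norm, norm_zero, ENNReal.ofReal_zero, zero_pow two_ne_zero]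
    calc ∫⁻ y, ‖_root_.fderiv ℝ g y‖ₑ ^ 2 ≤ ∫⁻ y, (closedBall (0 : EuclideanSpace ℝ (Fin 2)) 3).indicator (lift H) y :=
          lintegral_mono hpt
      _ = ∫⁻ y in closedBall (0 : EuclideanSpace ℝ (Fin 2)) 3, lift H y := lintegral_indicator measurableSet_closedBall _
      _ ≤ W * ∫⁻ x, H x := setLIntegral_lift_le hHm subset_rfl (by norm_num)
      _ = W * ((4 + 2 * ENNReal.ofReal (B ^ 2)) *
            ((∫⁻ x, ‖φ x‖ₑ ^ 2) + ∑ i, ∫⁻ x, ‖partialDeriv i φ x‖ₑ ^ 2)) := by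
          rw [hH]
          dsimp only
          rw [lintegral_const_mul'' _ hfg, lintegral_add_left' hmeas2,
            lintegral_finsetSum' _ fun i _ => hmeasD i]
  -- assemble
  calc ∫⁻ x, ‖φ x‖ₑ ^ 4 ≤ ∫⁻ y, ‖g y‖ₑ ^ 4 := hlhs
    _ ≤ 4 * CG * ((∫⁻ y, ‖g y‖ₑ ^ 2) * ∫⁻ y, ‖_root_.fderiv ℝ g y‖ₑ ^ 2) := hplanar
    _ ≤ 4 * CG * ((W * ∫⁻ x, ‖φ x‖ₑ ^ 2) * (W * ((4 + 2 * ENNReal.ofReal (B ^ 2)) *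
          ((∫⁻ x, ‖φ x‖ₑ ^ 2) + ∑ i, ∫⁻ x, ‖partialDeriv i φ x‖ₑ ^ 2)))) := by gcongr
    _ = 4 * CG * (W * (W * (4 + 2 * ENNReal.ofReal (B ^ 2)))) * ((∫⁻ x, ‖φ x‖ₑ ^ 2) *
          ((∫⁻ x, ‖φ x‖ₑ ^ 2) + ∑ i, ∫⁻ x, ‖partialDeriv i φ x‖ₑ ^ 2)) := by ring

end Torus

end Literature.Analysis.FunctionSpaces

end
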